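import Literature.NumberTheory.LFunctions.MauduitRivatVanDerCorput
import HarnessLib

/-!
# Van der Corput with dilation for a FAMILY of sequences, correlations summed inside (Mauduit–Rivat 2015, Lemma 3 as used in (51)–(54); proved)

Everything in this file is PROVED. `MauduitRivatVanDerCorput.vanDerCorput_dilated` majorises the
correlations of ONE sequence by their absolute values. In the type-II estimate of C. Mauduit,
J. Rivat, J. Eur. Math. Soc. 17 (2015) the inequality (19) is applied to each inner sum and
then SUMMED over the outer variable with the real parts kept ("Applying Lemma 3 to the
summation over `n` … and then summing over `m` we get
`|S_II|² ≪ M²N²/R + (MN/R) ∑_{1≤r<R} (1 − r/R) Re(S₁(r))` with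
`S₁(r) = ∑_m ∑_n b_{n+r} \bar b_n f(mn+mr) \bar f(mn) e(ϑmr)`", p. 2611, and again in (54)),
so that the absolute value ends up OUTSIDE the sum over the family. We prove this form for
sequences with values in a complex inner product space (C. Müllner's matrix-valued setting,
Duke Math. J. 166 (2017), §5.4):

* `vanDerCorput_dilated_re` — the intermediate inequality for one sequence,
  `H² ‖∑ z(n)‖² ≤ (b − a + kH) ∑_{j,j'<H} Re C(k(j − j'))`;
* `corrE_neg_eq_conj` — `C(−d) = conj C(d)`;
* `vanDerCorput_family` — for a finite family `z_i` supported in `(a, b]`,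
  `H² ∑_i ‖∑_n z_i(n)‖² ≤ (b − a + kH) · H · (∑_i ∑_n ‖z_i(n)‖² + 2 ∑_{1≤d<H} ‖∑_i C_i(kd)‖)`.

## References
* C. Mauduit, J. Rivat, J. Eur. Math. Soc. 17 (2015), Lemma 3 and pp. 2611–2612 ((51)–(54)).
  [MauduitRivat2015]
* C. Müllner, Duke Math. J. 166 (2017), §5.4 (proof of Prop. 5.5). [Mullner2017]
-/

noncomputable section

open Finset Complex
open scoped InnerProductSpace ComplexConjugate

namespace Literature.NumberTheory.LFunctions.MauduitRivat

variable {E : Type*} [NormedAddCommGroup E] [InnerProductSpace ℂ E]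

section One

variable {z : ℤ → E} {a b : ℤ} (hz : ∀ n, n ∉ Ioc a b → z n = 0)
include hz

/-- `C(−d) = conj C(d)` for a sequence supported in `(a, b]`. [folklore] -/
theorem corrE_neg_eq_conj (d : ℤ) : corrE z a b (-d) = conj (corrE z a b d) := by
  rw [corrE, corrE, map_sum]
  have h1 : ∑ n ∈ Ioc a b, ⟪z (n + -d), z n⟫_ℂ =
      ∑ n ∈ Ioc (a - |d| - |d|) (b + |d|), ⟪z (n + -d), z n⟫_ℂ := by
    refine (sum_eq_sum_of_vanish' (Ioc_subset_Ioc (by linarith [abs_nonneg d])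
      (by linarith [abs_nonneg d])) ?_).symm
    intro n hn; rw [hz n hn, inner_zero_right]
  have h2 : ∑ n ∈ Ioc a b, conj ⟪z (n + d), z n⟫_ℂ =
      ∑ m ∈ Ioc (a - |d| - |d|) (b + |d|), ⟪z (m + -d), z m⟫_ℂ := by
    have h3 : ∑ n ∈ Ioc a b, conj ⟪z (n + d), z n⟫_ℂ =
        ∑ n ∈ Ioc (a - |d| - |d| - d) (b + |d| - d), conj ⟪z (n + d), z n⟫_ℂ := by
      refine (sum_eq_sum_of_vanish' (Ioc_subset_Ioc (by cases abs_cases d <;> linarith)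
        (by cases abs_cases d <;> linarith)) ?_).symm
      intro n hn; rw [hz n hn, inner_zero_right, map_zero]
    rw [h3]
    have h4 := sum_Ioc_shift' (fun m => ⟪z (m + -d), z m⟫_ℂ) (a - |d| - |d| - d) (b + |d| - d) d
    simp only [sub_add_cancel] at h4
    rw [← h4]
    refine sum_congr rfl fun n _ => ?_
    rw [inner_conj_symm, show n + d + -d = n by ring]
  rw [h1, h2]

/-- **Van der Corput with dilation, real-part form** (the intermediate inequality of the proof of
Mauduit–Rivat's Lemma 3): for `z` supported in `(a, b]`, `a ≤ b`, `1 ≤ H`, `1 ≤ k`,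
`H² ‖∑ z(n)‖² ≤ (b − a + kH) ∑_{j,j'<H} Re C(k(j − j'))`. [cite: MauduitRivat2015, Lemma 3] -/
theorem vanDerCorput_dilated_re (hab : a ≤ b) {H : ℕ} (hH : 1 ≤ H) {k : ℤ} (hk : 1 ≤ k) :
    (H : ℝ) ^ 2 * ‖∑ n ∈ Ioc a b, z n‖ ^ 2 ≤
      ((b : ℝ) - a + k * H) * ∑ j ∈ range H, ∑ j' ∈ range H,
        (corrE z a b (k * ((j : ℤ) - j'))).re := by
  set S := ∑ n ∈ Ioc a b, z n with hS
  set M : Finset ℤ := Ioc (a - k * H) b with hM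
  have hkH : 0 ≤ k * H := by positivity
  have hcardM : (M.card : ℝ) = (b : ℝ) - a + k * H := by
    rw [hM, Int.card_Ioc]
    have h0 : 0 ≤ b - (a - k * H) := by linarith
    have h1 : (((b - (a - k * H)).toNat : ℕ) : ℤ) = b - (a - k * H) := Int.toNat_of_nonneg h0
    have h2 : (((b - (a - k * H)).toNat : ℕ) : ℝ) = ((b - (a - k * H) : ℤ) : ℝ) := by
      exact_mod_cast h1
    rw [h2]; push_cast; ring
  have hshift : ∀ j ∈ range H, ∑ m ∈ M, z (m + k * j) = S := by
    intro j hj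
    rw [mem_range] at hj
    rw [hM, sum_Ioc_shift', hS]
    have hj' : k * j ≤ k * H := by
      have : (j : ℤ) ≤ H := by exact_mod_cast hj.le
      nlinarith
    have hj0 : 0 ≤ k * (j : ℤ) := by positivity
    exact sum_eq_sum_of_vanish' (Ioc_subset_Ioc (by linarith) (by linarith)) hz
  have hHS : (H : ℂ) • S = ∑ m ∈ M, ∑ j ∈ range H, z (m + k * j) := by
    rw [sum_comm, sum_congr rfl hshift, sum_const, card_range, ← Nat.cast_smul_eq_nsmul ℂ]
  have hCS := norm_sq_sum_le_card_mul' M (fun m => ∑ j ∈ range H, z (m + k * j))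
  have hexp : ∑ m ∈ M, ‖∑ j ∈ range H, z (m + k * j)‖ ^ 2 =
      ∑ j ∈ range H, ∑ j' ∈ range H, (corrE z a b (k * ((j : ℤ) - j'))).re := by
    rw [sum_congr rfl fun m _ => norm_sq_sum_eq_re_inner _ (fun j => z (m + k * j)), sum_comm]
    refine sum_congr rfl fun j hj => ?_
    rw [sum_comm]
    refine sum_congr rfl fun j' hj' => ?_
    rw [← Complex.re_sum]
    congr 1
    rw [mem_range] at hj hj'
    have h2 := sum_Ioc_shift' (fun n => ⟪z (n + k * ((j : ℤ) - j')), z n⟫_ℂ) (a - k * H) b (k * j')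
    have h3 : ∀ m : ℤ, ⟪z (m + k * j), z (m + k * j')⟫_ℂ =
        ⟪z (m + k * j' + k * ((j : ℤ) - j')), z (m + k * j')⟫_ℂ := by
      intro m
      have : m + k * j' + k * ((j : ℤ) - j') = m + k * j := by ring
      rw [this]
    rw [hM, sum_congr rfl (fun m _ => h3 m), h2, corrE]
    have hj0 : 0 ≤ k * (j' : ℤ) := by positivity
    have hj'' : k * (j' : ℤ) ≤ k * H := by
      have : (j' : ℤ) ≤ H := by exact_mod_cast hj'.le
      nlinarith
    apply sum_eq_sum_of_vanish' (Ioc_subset_Ioc (by linarith) (by linarith))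
    intro n hn
    rw [hz n hn, inner_zero_right]
  have hnormHS : (H : ℝ) ^ 2 * ‖S‖ ^ 2 = ‖(H : ℂ) • S‖ ^ 2 := by
    rw [norm_smul, Complex.norm_natCast]; ring
  rw [hnormHS, hHS]
  calc ‖∑ m ∈ M, ∑ j ∈ range H, z (m + k * j)‖ ^ 2
      ≤ M.card * ∑ m ∈ M, ‖∑ j ∈ range H, z (m + k * j)‖ ^ 2 := hCS
    _ = _ := by rw [hcardM, hexp]

end One

/-- The combinatorial step of the proof of Lemma 3, for an abstract correlation function `C`
with `C(0) = P ≥ 0` real and `‖C(−d)‖ = ‖C(d)‖`: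
`∑_{j,j'<H} Re C(k(j−j')) ≤ H (P + 2 ∑_{1≤d<H} ‖C(kd)‖)`. [cite: MauduitRivat2015, Lemma 3] -/
theorem sum_sum_re_corr_le {C : ℤ → ℂ} {P : ℝ} (hP : C 0 = (P : ℂ)) (hP0 : 0 ≤ P)
    (hsymm : ∀ d : ℤ, ‖C (-d)‖ = ‖C d‖) (H : ℕ) (k : ℤ) :
    ∑ j ∈ range H, ∑ j' ∈ range H, (C (k * ((j : ℤ) - j'))).re ≤
      H * (P + 2 * ∑ d ∈ Ico (1 : ℤ) H, ‖C (k * d)‖) := by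
  have hg0 : ∀ d ∈ Ico (1 : ℤ) H, 0 ≤ ‖C (k * d)‖ := fun d _ => norm_nonneg _
  have hrow : ∀ j ∈ range H, ∑ j' ∈ range H, (C (k * ((j : ℤ) - j'))).re ≤
      P + 2 * ∑ d ∈ Ico (1 : ℤ) H, ‖C (k * d)‖ := by
    intro j hj
    rw [mem_range] at hj
    have hle : ∀ j' ∈ range H, (C (k * ((j : ℤ) - j'))).re ≤ ‖C (k * ((j : ℤ) - j'))‖ :=
      fun j' _ => Complex.re_le_norm _
    refine (sum_le_sum hle).trans ?_
    rw [range_eq_Ico, ← sum_Ico_consecutive _ (Nat.zero_le j) hj.le,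
      sum_eq_sum_Ico_succ_bot hj, sub_self, mul_zero, hP, Complex.norm_real,
      Real.norm_of_nonneg hP0]
    have hlow : ∑ j' ∈ Ico 0 j, ‖C (k * ((j : ℤ) - j'))‖ ≤ ∑ d ∈ Ico (1 : ℤ) H, ‖C (k * d)‖ := by
      rw [← sum_image (f := fun d : ℤ => ‖C (k * d)‖) (s := Ico 0 j) (g := fun j' : ℕ => (j : ℤ) - j')]
      · apply sum_le_sum_of_subset_of_nonneg
        · intro d hd
          rw [mem_image] at hd
          obtain ⟨j', hj', rfl⟩ := hd
          rw [mem_Ico] at hj' ⊢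
          omega
        · intro d _ _; exact norm_nonneg _
      · intro x _ y _ hxy
        have : (x : ℤ) = y := by linarith
        exact_mod_cast this
    have hup : ∑ j' ∈ Ico (j + 1) H, ‖C (k * ((j : ℤ) - j'))‖ ≤ ∑ d ∈ Ico (1 : ℤ) H, ‖C (k * d)‖ := by
      have hsymm' : ∀ j' ∈ Ico (j + 1) H, ‖C (k * ((j : ℤ) - j'))‖ = ‖C (k * ((j' : ℤ) - j))‖ := by
        intro j' _
        have : k * ((j : ℤ) - j') = -(k * ((j' : ℤ) - j)) := by ring
        rw [this, hsymm]
      rw [sum_congr rfl hsymm', ← sum_image (f := fun d : ℤ => ‖C (k * d)‖)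
          (s := Ico (j + 1) H) (g := fun j' : ℕ => (j' : ℤ) - j)]
      · apply sum_le_sum_of_subset_of_nonneg
        · intro d hd
          rw [mem_image] at hd
          obtain ⟨j', hj', rfl⟩ := hd
          rw [mem_Ico] at hj' ⊢
          omega
        · intro d _ _; exact norm_nonneg _
      · intro x _ y _ hxy
        have : (x : ℤ) = y := by linarith
        exact_mod_cast this
    have hsum0 : 0 ≤ ∑ d ∈ Ico (1 : ℤ) H, ‖C (k * d)‖ := sum_nonneg hg0
    linarith
  calc ∑ j ∈ range H, ∑ j' ∈ range H, (C (k * ((j : ℤ) - j'))).re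
      ≤ ∑ _j ∈ range H, (P + 2 * ∑ d ∈ Ico (1 : ℤ) H, ‖C (k * d)‖) := sum_le_sum hrow
    _ = H * (P + 2 * ∑ d ∈ Ico (1 : ℤ) H, ‖C (k * d)‖) := by
        rw [sum_const, card_range, nsmul_eq_mul]

/-- **Van der Corput with dilation for a family, correlations summed inside** (Mauduit–Rivat's
Lemma 3 as applied in (51)–(54)): for a finite family `z_i` (`i ∈ I`) of `E`-valued sequences
supported in `(a, b]`, `a ≤ b`, `1 ≤ H`, `1 ≤ k`,
`H² ∑_i ‖∑_n z_i(n)‖² ≤ (b − a + kH) · H · (∑_i ∑_n ‖z_i(n)‖² + 2 ∑_{1≤d<H} ‖∑_i C_i(kd)‖)`.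
[cite: MauduitRivat2015, Lemma 3 and (51), (54)] -/
theorem vanDerCorput_family {ι : Type*} (I : Finset ι) {z : ι → ℤ → E} {a b : ℤ}
    (hz : ∀ i ∈ I, ∀ n, n ∉ Ioc a b → z i n = 0) (hab : a ≤ b) {H : ℕ} (hH : 1 ≤ H) {k : ℤ}
    (hk : 1 ≤ k) :
    (H : ℝ) ^ 2 * ∑ i ∈ I, ‖∑ n ∈ Ioc a b, z i n‖ ^ 2 ≤
      ((b : ℝ) - a + k * H) * (H * (∑ i ∈ I, ∑ n ∈ Ioc a b, ‖z i n‖ ^ 2 +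
        2 * ∑ d ∈ Ico (1 : ℤ) H, ‖∑ i ∈ I, corrE (z i) a b (k * d)‖)) := by
  have hkH : (0 : ℝ) ≤ k * H := by
    have : (0 : ℤ) ≤ k * H := by positivity
    exact_mod_cast this
  have hab' : (a : ℝ) ≤ b := by exact_mod_cast hab
  have hfac : 0 ≤ (b : ℝ) - a + k * H := by linarith
  -- sum the real-part form over the family
  calc (H : ℝ) ^ 2 * ∑ i ∈ I, ‖∑ n ∈ Ioc a b, z i n‖ ^ 2
      = ∑ i ∈ I, (H : ℝ) ^ 2 * ‖∑ n ∈ Ioc a b, z i n‖ ^ 2 := by rw [mul_sum]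
    _ ≤ ∑ i ∈ I, ((b : ℝ) - a + k * H) * ∑ j ∈ range H, ∑ j' ∈ range H,
          (corrE (z i) a b (k * ((j : ℤ) - j'))).re :=
        sum_le_sum fun i hi => vanDerCorput_dilated_re (hz i hi) hab hH hk
    _ = ((b : ℝ) - a + k * H) * ∑ j ∈ range H, ∑ j' ∈ range H,
          (∑ i ∈ I, corrE (z i) a b (k * ((j : ℤ) - j'))).re := by
        rw [← mul_sum]
        congr 1
        rw [sum_comm]
        refine sum_congr rfl fun j _ => ?_
        rw [sum_comm]
        refine sum_congr rfl fun j' _ => ?_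
        rw [Complex.re_sum]
    _ ≤ ((b : ℝ) - a + k * H) * (H * (∑ i ∈ I, ∑ n ∈ Ioc a b, ‖z i n‖ ^ 2 +
          2 * ∑ d ∈ Ico (1 : ℤ) H, ‖∑ i ∈ I, corrE (z i) a b (k * d)‖)) := by
        refine mul_le_mul_of_nonneg_left ?_ hfac
        refine sum_sum_re_corr_le (C := fun d => ∑ i ∈ I, corrE (z i) a b d)
          (P := ∑ i ∈ I, ∑ n ∈ Ioc a b, ‖z i n‖ ^ 2) ?_ ?_ ?_ H k
        · push_cast
          exact sum_congr rfl fun i _ => by rw [corrE_zero (z i) a b]; push_cast; rfl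
        · exact sum_nonneg fun i _ => sum_nonneg fun n _ => sq_nonneg _
        · intro d
          have : (∑ i ∈ I, corrE (z i) a b (-d)) = conj (∑ i ∈ I, corrE (z i) a b d) := by
            rw [map_sum]
            exact sum_congr rfl fun i hi => corrE_neg_eq_conj (hz i hi) d
          simp only [this, Complex.norm_conj]

end Literature.NumberTheory.LFunctions.MauduitRivat
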